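import Summits.Ventures.HodgeRepro2.T5CyclotomicPlusGalois

/-!
# NUMERALS ON `ℚ(ζ₁₃)`: the primes `3` (order `3`, splits) and `103 ≡ −1` (order `2`, stays prime) — both quadratic
# RESIDUES modulo `13`, so the parity of the order, not the quadratic character, decides

Tier-5 support N3 / §G-N4.2 (seat p3, gen 79). On the field of record `ℚ(ζ₇)` the criterion of file 272 («`v ∣ p`
stays prime iff `orderOf (p mod ℓ)` is even») coincides with «`p` is a quadratic non-residue» (file 266) because
`7 ≡ 3 (mod 4)`. On `ℚ(ζ₁₃)` (`13 ≡ 1 (mod 4)`, the quadratic subfield `ℚ(√13)` is real) it does not: `3 ≡ 4²` and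
`103 ≡ 12 ≡ 5²` are both squares modulo `13`, yet `3` has order `3` (every place of `ℚ(ζ₁₃)⁺` above `3` has two
places of `ℚ(ζ₁₃)` above it, `N(v) = 27`, two such places) and `103` has order `2` (every place above `103` stays
prime, `N(v) = 103`, six such places):

* `orderOf_three_zmod_thirteen`, `orderOf_natCast_hundredThree_zmod_thirteen`, `isSquare_three_zmod_thirteen`,
  `isSquare_hundredThree_zmod_thirteen` — the arithmetic modulo `13`;
* **`ncard_primesOver_three`**, **`absNorm_three`**, **`ncard_primesOver_int_three`** — at `3`: two places of
  `ℚ(ζ₁₃)` above `v`, `N(v) = 27`, two places of `ℚ(ζ₁₃)⁺` above `3`;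
* **`exists_map_eq_hundredThree`**, **`absNorm_hundredThree`**, **`ncard_primesOver_int_hundredThree`** — at `103`:
  `v` stays prime, `N(v) = 103`, six places of `ℚ(ζ₁₃)⁺` above `103`.

§8(d): uses an L-value-free non-vanishing device: NO.
-/

open NumberField NumberField.IsCMField IsDedekindDomain IsDedekindDomain.HeightOneSpectrum Module Polynomial
open Summit.Ventures.HodgeRepro2.T5CyclotomicStaysPrimeIffEven Summit.Ventures.HodgeRepro2.T5CyclotomicHeckeCommutative
  Summit.Ventures.HodgeRepro2.T5CyclotomicPlusGalois

namespace Summit.Ventures.HodgeRepro2.T5CyclotomicThirteenNumerals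

section Arithmetic

/-- `13` is prime (as a `Fact`). -/
theorem fact_prime_thirteen : Fact (Nat.Prime 13) := ⟨by norm_num⟩

/-- `3` is prime (as a `Fact`). -/
theorem fact_prime_three : Fact (Nat.Prime 3) := ⟨Nat.prime_three⟩

/-- `103` is prime (as a `Fact`). -/
theorem fact_prime_hundredThree : Fact (Nat.Prime 103) := ⟨by norm_num⟩

/-- `3` has order `3` modulo `13` (`27 = 2 · 13 + 1`). -/
theorem orderOf_natCast_three_zmod_thirteen : orderOf ((3 : ℕ) : ZMod 13) = 3 := by
  rw [Nat.cast_ofNat, orderOf_eq_iff (by norm_num)]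
  decide

/-- `103 ≡ 12 ≡ −1` has order `2` modulo `13`. -/
theorem orderOf_natCast_hundredThree_zmod_thirteen : orderOf ((103 : ℕ) : ZMod 13) = 2 := by
  rw [Nat.cast_ofNat, orderOf_eq_iff (by norm_num)]
  decide

/-- `3 ≡ 4²` is a square modulo `13`. -/
theorem isSquare_three_zmod_thirteen : IsSquare ((3 : ℕ) : ZMod 13) := ⟨4, by decide⟩

/-- `103 ≡ 12 ≡ 5²` is a square modulo `13`. -/
theorem isSquare_hundredThree_zmod_thirteen : IsSquare ((103 : ℕ) : ZMod 13) := ⟨5, by decide⟩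

/-- `3` is coprime to `13`. -/
theorem coprime_three_thirteen : Nat.Coprime 3 13 := by norm_num

/-- `103` is coprime to `13`. -/
theorem coprime_hundredThree_thirteen : Nat.Coprime 103 13 := by norm_num

end Arithmetic

section Thirteen

variable (K : Type*) [Field K] [CharZero K] [IsCyclotomicExtension {13} ℚ K]

section Three

variable (v : HeightOneSpectrum (𝓞 (maximalRealSubfield K))) [hv : v.asIdeal.LiesOver (Ideal.span {((3 : ℕ) : ℤ)})]
include hv

/-- **Two places of `ℚ(ζ₁₃)` above every place of `ℚ(ζ₁₃)⁺` above `3`** (order `3`, odd). -/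
theorem ncard_primesOver_three :
    haveI := numberFieldCyc 13 K; haveI := isCMFieldCyc 13 (by norm_num) K
    (v.asIdeal.primesOver (𝓞 K)).ncard = 2 := by
  haveI := numberFieldCyc 13 K
  haveI := isCMFieldCyc 13 (by norm_num) K
  haveI := fact_prime_thirteen
  haveI := fact_prime_three
  refine (ncard_primesOver_eq_two_iff_odd 13 (by norm_num) K 3 coprime_three_thirteen v).mpr ?_
  rw [orderOf_natCast_three_zmod_thirteen]
  decide

/-- **`N(v) = 3³ = 27`** at every place of `ℚ(ζ₁₃)⁺` above `3`. -/
theorem absNorm_three :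
    haveI := numberFieldCyc 13 K; haveI := isCMFieldCyc 13 (by norm_num) K
    Ideal.absNorm v.asIdeal = 27 := by
  haveI := numberFieldCyc 13 K
  haveI := isCMFieldCyc 13 (by norm_num) K
  haveI := fact_prime_thirteen
  haveI := fact_prime_three
  obtain ⟨⟨P, hP, hPo⟩⟩ := Ideal.nonempty_primesOver (S := 𝓞 K) v.asIdeal
  haveI := hP
  haveI := hPo
  have h := absNorm_eq_pow_of_odd 13 (by norm_num) K 3 coprime_three_thirteen v
    ⟨P, hP, Ideal.ne_bot_of_liesOver_of_ne_bot v.ne_bot P⟩ (hw := hPo)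
    (by rw [orderOf_natCast_three_zmod_thirteen]; decide)
  rw [h, orderOf_natCast_three_zmod_thirteen]
  norm_num

/-- **Two places of `ℚ(ζ₁₃)⁺` above `3`**: `(13 − 1)/(2 · 3) = 2`. -/
theorem ncard_primesOver_int_three :
    haveI := numberFieldCyc 13 K; haveI := isCMFieldCyc 13 (by norm_num) K
    ((Ideal.span {((3 : ℕ) : ℤ)}).primesOver (𝓞 (maximalRealSubfield K))).ncard = 2 := by
  haveI := numberFieldCyc 13 K
  haveI := isCMFieldCyc 13 (by norm_num) K
  haveI := fact_prime_thirteen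
  haveI := fact_prime_three
  have h := ncard_primesOver_int_of_odd 13 (by norm_num) K 3 coprime_three_thirteen v
    (by rw [orderOf_natCast_three_zmod_thirteen]; decide)
  rw [h, orderOf_natCast_three_zmod_thirteen]

end Three

section HundredThree

variable (v : HeightOneSpectrum (𝓞 (maximalRealSubfield K)))
  [hv : v.asIdeal.LiesOver (Ideal.span {((103 : ℕ) : ℤ)})]
include hv

/-- **Every place of `ℚ(ζ₁₃)⁺` above `103` stays prime in `ℚ(ζ₁₃)`** (order `2`, even) — although `103` is a square
modulo `13`. -/
theorem exists_map_eq_hundredThree :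
    haveI := numberFieldCyc 13 K; haveI := isCMFieldCyc 13 (by norm_num) K
    ∃ w : HeightOneSpectrum (𝓞 K),
      Ideal.map (algebraMap (𝓞 (maximalRealSubfield K)) (𝓞 K)) v.asIdeal = w.asIdeal := by
  haveI := numberFieldCyc 13 K
  haveI := isCMFieldCyc 13 (by norm_num) K
  haveI := fact_prime_thirteen
  haveI := fact_prime_hundredThree
  refine (exists_map_eq_iff_even 13 (by norm_num) K 103 coprime_hundredThree_thirteen v).mpr ?_
  rw [orderOf_natCast_hundredThree_zmod_thirteen]
  exact even_two

/-- **`N(v) = 103`** at every place of `ℚ(ζ₁₃)⁺` above `103` (`103^{2/2}`). -/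
theorem absNorm_hundredThree :
    haveI := numberFieldCyc 13 K; haveI := isCMFieldCyc 13 (by norm_num) K
    Ideal.absNorm v.asIdeal = 103 := by
  haveI := numberFieldCyc 13 K
  haveI := isCMFieldCyc 13 (by norm_num) K
  haveI := fact_prime_thirteen
  haveI := fact_prime_hundredThree
  obtain ⟨⟨P, hP, hPo⟩⟩ := Ideal.nonempty_primesOver (S := 𝓞 K) v.asIdeal
  haveI := hP
  haveI := hPo
  have h := absNorm_eq_pow_of_even 13 (by norm_num) K 103 coprime_hundredThree_thirteen v
    ⟨P, hP, Ideal.ne_bot_of_liesOver_of_ne_bot v.ne_bot P⟩ (hw := hPo)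
    (by rw [orderOf_natCast_hundredThree_zmod_thirteen]; exact even_two)
  rw [h, orderOf_natCast_hundredThree_zmod_thirteen]
  norm_num

/-- **Six places of `ℚ(ζ₁₃)⁺` above `103`**: `(13 − 1)/2 = 6`. -/
theorem ncard_primesOver_int_hundredThree :
    haveI := numberFieldCyc 13 K; haveI := isCMFieldCyc 13 (by norm_num) K
    ((Ideal.span {((103 : ℕ) : ℤ)}).primesOver (𝓞 (maximalRealSubfield K))).ncard = 6 := by
  haveI := numberFieldCyc 13 K
  haveI := isCMFieldCyc 13 (by norm_num) K
  haveI := fact_prime_thirteen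
  haveI := fact_prime_hundredThree
  have h := ncard_primesOver_int_of_even 13 (by norm_num) K 103 coprime_hundredThree_thirteen v
    (by rw [orderOf_natCast_hundredThree_zmod_thirteen]; exact even_two)
  rw [h, orderOf_natCast_hundredThree_zmod_thirteen]

end HundredThree

end Thirteen

end Summit.Ventures.HodgeRepro2.T5CyclotomicThirteenNumerals
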